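import Summits.QuantumAdvantage.QuantumAdvantage.Theorems.CubicForrelationNearExactIsExactTwelveLevelFiveCongruences

/-!
# Crux `CubicForrelation.NearExactIsExact` (stmt-QuantumAdvantage-14043) — n = 12, a level-5 side AT `Φ ≥ 29/32` that is NOT exact off
  its odd hyperplane: the off-hyperplane energy is exactly `1024` and sits on (a) a 4-point set of `±16`, (b) one point of `±32`, or
  (c) a 256-point set of `±2` with even 4-flat sections

Certificate seat `b2b-cforr-cert` (gen 23).  HONEST FRAMING: a kernel-checked structure theorem (standard axioms, no `decide`) about cubic
Boolean pairs on 12 bits — the case "not exact off `P`" of the level-5 branch at the boundary rung `29/32`, complementing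
`tw22_levelFive_ge2932_rigid` (exact off `P`).  Nothing is closed here; NO new value of `θ₁₂`.  NOT summit progress.
Paper proof: HOME/b2b-cforr-cert-g23/PROOF-N12-928-L5.md §2.

Setting: cubic `f, g`, `W_g = 32u'`, some `u'` odd, `Φ ≥ 29/32`; `P` = odd set (a coset `x_P ⊕ V`), `P'` = even set (`= x' ⊕ V`),
`e = u' − 2(−1)^f` (`l5c_setup`: `e² ≥ 1` on `P`, `e` even on `P'`, `Σ_{P'} e² ≤ 1024 ≤ 3072 − Σ_P e²`).  The layers
`O_D = {x ∈ P' : e/D odd}` (`D = 2, 4, 8, 16`) have EVEN intersection with every parametrised `r`-flat of `P'` (`r = 4, 5, 7, 10`) by the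
flat congruences `l5c_flat4/5/7/10`, so by the Reed–Muller distance on the coset (`ws_erm_round`) each is empty or has `≥ 2^{11−r+1}`…
precisely `≥ 256, 128, 32, 4` points, of energy `≥ 4, 16, 64, 256` each; the budget `1024` then leaves exactly the three configurations.

* `l5t_tight`: bookkeeping (a lower bound meeting the budget pins every term).
* `l5t_layer2`: some `e/2` odd on `P'` ⇒ configuration (c).   * `l5t_layer4`, `l5t_layer8`: `4 ∣ e ⇒ 8 ∣ e ⇒ 16 ∣ e` on `P'`.
* `l5t_layer16`: `16 ∣ e` on `P'` and some `e/16` odd ⇒ configuration (a).   * `l5t_layer32`: `32 ∣ e` on `P'`, not exact ⇒ configuration (b).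
* `tw23_levelFive_ge2932_offP`: the trichotomy.

References: J. Ax (1964) / R. J. McEliece (1972); MacWilliams–Sloane (1977) Ch. 13 §3–4.  Axioms: the standard three.
-/

set_option linter.dupNamespace false -- D-0017: single-problem summit ⇒ `QuantumAdvantage.QuantumAdvantage` by design

noncomputable section

namespace Summit.QuantumAdvantage.QuantumAdvantage.Theorems.CubicForrelation.NearExactIsExact

open Finset
open Literature.Computability.QuantumComplexity
open Literature.Computability.QuantumComplexity.BuzetChailloux (bxor zeroVec bxor_bxor_cancel_left bxor_zeroVec zeroVec_bxor bxor_comm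
  bxor_self twist_zeroVec_right twist_bxor_right)
open Literature.Computability.QuantumComplexity.DerivativeWalsh (W twist_bxor_left)
open Literature.Computability.QuantumComplexity.Simon (twist_eq_one_or)

/-! ### Bookkeeping -/

/-- **Tightness bookkeeping.**  Nonnegative `φ` on `S`, `O ⊆ S` with `φ ≥ c` on `O`, `Σ_S φ ≤ B ≤ c·#O`: then `φ = c` on `O`, `φ = 0` on
`S ∖ O`, and `Σ_S φ = B`. [folklore] -/
theorem l5t_tight {α : Type*} [DecidableEq α] (S O : Finset α) (φ : α → ℤ) (c B : ℤ) (hO : O ⊆ S)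
    (hc : ∀ x ∈ O, c ≤ φ x) (hnn : ∀ x ∈ S, 0 ≤ φ x) (hB : ∑ x ∈ S, φ x ≤ B) (hcO : B ≤ c * #O) :
    (∀ x ∈ O, φ x = c) ∧ (∀ x ∈ S, x ∉ O → φ x = 0) ∧ ∑ x ∈ S, φ x = B := by
  have hsplit : ∑ x ∈ S, φ x = ∑ x ∈ O, φ x + ∑ x ∈ S \ O, φ x := by
    rw [← sum_union (disjoint_sdiff), union_sdiff_of_subset hO]
  have hO_ge : c * #O ≤ ∑ x ∈ O, φ x := by
    have h := sum_le_sum hc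
    rw [sum_const, nsmul_eq_mul, mul_comm] at h
    exact h
  have hR_ge : 0 ≤ ∑ x ∈ S \ O, φ x := sum_nonneg fun x hx => hnn x (mem_sdiff.1 hx).1
  have hOeq : ∑ x ∈ O, (φ x - c) = 0 := by
    rw [sum_sub_distrib, sum_const, nsmul_eq_mul]; linarith
  have hReq : ∑ x ∈ S \ O, φ x = 0 := by linarith
  refine ⟨fun x hx => ?_, fun x hx hxO => ?_, by linarith⟩
  · have h := (sum_eq_zero_iff_of_nonneg fun y hy => sub_nonneg.2 (hc y hy)).1 hOeq x hx
    linarith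
  · exact (sum_eq_zero_iff_of_nonneg fun y hy => hnn y (mem_sdiff.1 hy).1).1 hReq x (mem_sdiff.2 ⟨hx, hxO⟩)

/-- An odd integer has square `≥ 1`; `e = D·q` with `q` odd has `e² ≥ D²`. [folklore] -/
theorem l5t_sq_ge_of_odd_quot (e D : ℤ) (hD : 0 < D) (hdvd : D ∣ e) (hodd : Odd (e / D)) : D ^ 2 ≤ e ^ 2 := by
  obtain ⟨q, hq⟩ := hdvd
  have hqD : e / D = q := by rw [hq]; exact Int.mul_ediv_cancel_left q hD.ne'
  rw [hqD] at hodd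
  have h0 := Int.odd_iff.1 hodd
  have hq1 : 1 ≤ q ^ 2 := by
    have : q ≤ -1 ∨ 1 ≤ q := by omega
    have := tp_sq_ge (k := 1) (by norm_num) this
    linarith
  rw [hq]
  nlinarith

/-! ### The layers of the off-hyperplane residual -/

/-- **Layer `2`: some `e/2` odd off `P` ⇒ configuration (c).**  Cubic `f, g`, `W_g = 32u'`, some `u'` odd, `Φ ≥ 29/32`; if `e/2` is odd at
some point of the even set `P'` then: the set `A = {x ∈ P' : e/2 odd}` has exactly `256` points, `e² = 4` on `A`, `e = 0` on `P' ∖ A`,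
`e² = 1` on `P`, and `A` meets every parametrised 4-flat of `P'` (base point in `P'`, directions periods of `P`) in an even number of
points.  [this work] -/
theorem l5t_layer2 (f g : (Fin (6 + 6) → Bool) → Bool) (hf : IsDegLeFun 3 f) (hg : IsDegLeFun 3 g)
    (u' : (Fin (6 + 6) → Bool) → ℤ) (hu' : ∀ x, W (fun y => signOf (g y)) x = (2 : ℝ) ^ 5 * (u' x : ℝ))
    (hodd : ∃ x, Odd (u' x)) (hΦ : (29 / 32 : ℝ) ≤ forrelation f g)
    (h2 : ∃ x, ¬ Odd (u' x) ∧ Odd ((u' x - 2 * sZ (f x)) / 2)) :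
    #((univ.filter fun x : Fin (6 + 6) → Bool => ¬ Odd (u' x)).filter fun x => Odd ((u' x - 2 * sZ (f x)) / 2)) = 256 ∧
    (∀ x, ¬ Odd (u' x) → Odd ((u' x - 2 * sZ (f x)) / 2) → (u' x - 2 * sZ (f x)) ^ 2 = 4) ∧
    (∀ x, ¬ Odd (u' x) → ¬ Odd ((u' x - 2 * sZ (f x)) / 2) → u' x - 2 * sZ (f x) = 0) ∧
    (∀ x, Odd (u' x) → (u' x - 2 * sZ (f x)) ^ 2 = 1) ∧
    (∀ (b : Fin (6 + 6) → Bool), ¬ Odd (u' b) → ∀ (a : Fin 4 → Fin (6 + 6) → Bool),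
      (∀ i x, (Odd (u' (bxor x (a i))) ↔ Odd (u' x))) →
      Even #(univ.filter fun ε : Fin 4 → Bool =>
        Odd ((u' (fun j => b j ^^ decide (Odd #(univ.filter fun i => ε i && a i j))) -
          2 * sZ (f (fun j => b j ^^ decide (Odd #(univ.filter fun i => ε i && a i j))))) / 2))) := by
  classical
  obtain ⟨V, xP, x', h0, hadd, hcardV, hS, hS', hcardP, hcardP', hsq1, heven, hsum, hoff⟩ :=
    l5c_setup f g hg u' hu' hodd hΦ
  set P := univ.filter (fun x : Fin (6 + 6) → Bool => Odd (u' x)) with hPdef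
  set P' := univ.filter (fun x : Fin (6 + 6) → Bool => ¬ Odd (u' x)) with hP'def
  set e : (Fin (6 + 6) → Bool) → ℤ := fun x => u' x - 2 * sZ (f x) with hedef
  have hmemP' : ∀ x, x ∈ P' ↔ ¬ Odd (u' x) := fun x => by simp [hP'def]
  have hmemV : ∀ a, a ∈ V ↔ ∀ x, (Odd (u' (bxor x a)) ↔ Odd (u' x)) := by
    intro a
    constructor
    · intro ha x
      constructor
      · intro h
        by_contra hx
        have h1 : x ∈ P' := (hmemP' x).2 hx
        rw [hS'] at h1
        have h2 := fl1_coset_vadd hadd rfl h1 ha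
        rw [← hS'] at h2
        exact (hmemP' _).1 h2 h
      · intro h
        have h1 : x ∈ P := by simp [hPdef, h]
        rw [hS] at h1
        have h2 := fl1_coset_vadd hadd rfl h1 ha
        rw [← hS] at h2
        simpa [hPdef] using h2
    · intro h
      -- `a` is a period of the odd indicator, hence in `V` (the period group has exactly the periods... via the coset description)
      have hx' : x' ∈ P' := by rw [hS']; exact mem_image.2 ⟨zeroVec, h0, bxor_zeroVec _⟩
      have h1 : bxor x' a ∈ P' := (hmemP' _).2 (fun hh => (hmemP' x').1 hx' ((h x').1 hh))
      rw [hS'] at h1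
      obtain ⟨v, hv, hv'⟩ := mem_image.1 h1
      have : a = v := by
        have := congrArg (bxor x') hv'
        rw [bxor_bxor_cancel_left, bxor_bxor_cancel_left] at this
        exact this.symm
      rw [this]; exact hv
  -- the 4-flat parity hypothesis of `ws_erm_round` for `ψ = e/2` on `P' = x' ⊕ V`
  have hPV' : ∀ x, x ∈ V.image (bxor x') → ∀ a ∈ V, bxor x a ∈ V.image (bxor x') :=
    fun x hx a ha => fl1_coset_vadd hadd rfl hx ha
  have H : ∀ b ∈ V.image (bxor x'), ∀ a : Fin (3 + 1) → Fin (6 + 6) → Bool, (∀ i, a i ∈ V) →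
      (2 : ℤ) ∣ ∑ ε : Fin (3 + 1) → Bool, e (fun j => b j ^^ decide (Odd #(univ.filter fun i => ε i && a i j))) / 2 := by
    intro b hb a ha
    have h4 := l5c_flat4 f g hf hg u' hu' b a
    have hev : ∀ ε : Fin (3 + 1) → Bool, Even (e (fun j => b j ^^ decide (Odd #(univ.filter fun i => ε i && a i j)))) := by
      intro ε
      have hmem := ws_flatPt_mem V h0 (fun x => x ∈ V.image (bxor x')) hPV' (3 + 1) b hb a ha ε
      rw [← hS'] at hmem
      exact heven _ ((hmemP' _).1 hmem)
    have hsum2 : ∑ ε : Fin (3 + 1) → Bool, e (fun j => b j ^^ decide (Odd #(univ.filter fun i => ε i && a i j))) =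
        2 * ∑ ε : Fin (3 + 1) → Bool, e (fun j => b j ^^ decide (Odd #(univ.filter fun i => ε i && a i j))) / 2 := by
      rw [mul_sum]
      exact sum_congr rfl fun ε _ => (Int.two_mul_ediv_two_of_even (hev ε)).symm
    change (4 : ℤ) ∣ ∑ ε : Fin 4 → Bool, e (fun j => b j ^^ decide (Odd #(univ.filter fun i => ε i && a i j))) at h4
    change (4 : ℤ) ∣ ∑ ε : Fin (3 + 1) → Bool, e (fun j => b j ^^ decide (Odd #(univ.filter fun i => ε i && a i j))) at h4
    rw [hsum2] at h4
    have : (2 : ℤ) * 2 ∣ 2 * ∑ ε : Fin (3 + 1) → Bool, e (fun j => b j ^^ decide (Odd #(univ.filter fun i => ε i && a i j))) / 2 := by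
      simpa using h4
    exact (mul_dvd_mul_iff_left two_ne_zero).1 this
  have hround := ws_erm_round V h0 hadd hcardV x' (fun x => e x / 2) 3 H
  rw [← hS'] at hround
  set A := P'.filter (fun x => Odd (e x / 2)) with hAdef
  have hA_ge : 256 ≤ #A := by
    rcases hround with hall | hbig
    · exfalso
      obtain ⟨x, hx, hxodd⟩ := h2
      exact (Int.not_odd_iff_even.2 (hall x ((hmemP' x).2 hx))) hxodd
    · change 2 ^ 11 ≤ 2 ^ 3 * #A at hbig
      norm_num at hbig
      omega
  -- energy
  have hAsub : A ⊆ P' := filter_subset _ _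
  have hc : ∀ x ∈ A, (4 : ℤ) ≤ e x ^ 2 := by
    intro x hx
    have hx' := (mem_filter.1 hx)
    have hev : Even (e x) := heven x ((hmemP' x).1 hx'.1)
    have h := l5t_sq_ge_of_odd_quot (e x) 2 (by norm_num) (even_iff_two_dvd.1 hev) hx'.2
    linarith
  have hoff' : ∑ x ∈ P', e x ^ 2 ≤ 1024 := hoff
  have hcA : (1024 : ℤ) ≤ 4 * #A := by
    have : (256 : ℤ) ≤ #A := by exact_mod_cast hA_ge
    linarith
  obtain ⟨hAval, hrest, hE⟩ := l5t_tight P' A (fun x => e x ^ 2) 4 1024 hAsub hc (fun x _ => sq_nonneg _) hoff' hcA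
  have hA_le : #A ≤ 256 := by
    have h := sum_le_sum hc
    rw [sum_const, nsmul_eq_mul] at h
    have h' : ∑ x ∈ A, e x ^ 2 ≤ ∑ x ∈ P', e x ^ 2 := sum_le_sum_of_subset_of_nonneg hAsub fun x _ _ => sq_nonneg _
    have : (#A : ℤ) * 4 ≤ 1024 := by linarith
    have : (#A : ℤ) ≤ 256 := by linarith
    exact_mod_cast this
  have hcardA : #A = 256 := le_antisymm hA_le hA_ge
  -- on `P`: all `e² = 1`
  have hPall : ∀ x ∈ P, e x ^ 2 = 1 := by
    have hPsum : ∑ x ∈ P, e x ^ 2 ≤ 2048 := by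
      have : ∑ x ∈ P, e x ^ 2 + ∑ x ∈ P', e x ^ 2 ≤ 3072 := hsum
      linarith
    have hc1 : ∀ x ∈ P, (1 : ℤ) ≤ e x ^ 2 := fun x hx => hsq1 x (by simpa [hPdef] using hx)
    have hcP : (2048 : ℤ) ≤ 1 * #P := by rw [hcardP]; norm_num
    obtain ⟨h1, -, -⟩ := l5t_tight P P (fun x => e x ^ 2) 1 2048 Subset.rfl hc1 (fun x _ => sq_nonneg _) hPsum hcP
    exact h1
  refine ⟨hcardA, fun x hx hxodd => hAval x (mem_filter.2 ⟨(hmemP' x).2 hx, hxodd⟩),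
    fun x hx hxev => ?_, fun x hx => hPall x (by simp [hPdef, hx]), fun b hb a ha => ?_⟩
  · have h := hrest x ((hmemP' x).2 hx) (fun hmem => hxev (mem_filter.1 hmem).2)
    have : e x ^ 2 = 0 := h
    exact pow_eq_zero_iff (n := 2) (by norm_num) |>.1 this
  · have hb' : b ∈ V.image (bxor x') := by rw [← hS']; exact (hmemP' b).2 hb
    have ha' : ∀ i, a i ∈ V := fun i => (hmemV (a i)).2 (ha i)
    have h := H b hb' a ha'
    have hE := (tw_even_sum_iff univ _).1 (even_iff_two_dvd.2 h)
    exact hE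

/-- **Doubling step.**  On the coset `x' ⊕ V` suppose `D ∣ e` and every parametrised `(r+1)`-flat sum of `e` (any base point, any
directions) is `≡ 0 (mod 2D)`.  Then either `2D ∣ e` on the coset, or `e/D` is odd on at least `2^{11−r}` of its points
(Reed–Muller distance on the coset, `ws_erm_round`). [this work] -/
theorem l5t_double (V : Finset (Fin (6 + 6) → Bool)) (x' : Fin (6 + 6) → Bool) (h0 : zeroVec ∈ V)
    (hadd : ∀ a ∈ V, ∀ b ∈ V, bxor a b ∈ V) (hcardV : #V = 2 ^ 11) (e : (Fin (6 + 6) → Bool) → ℤ) (D : ℤ) (hD : 0 < D) (r : ℕ)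
    (hdiv : ∀ x ∈ V.image (bxor x'), D ∣ e x)
    (hcong : ∀ (b : Fin (6 + 6) → Bool) (a : Fin (r + 1) → Fin (6 + 6) → Bool),
      2 * D ∣ ∑ ε : Fin (r + 1) → Bool, e (fun j => b j ^^ decide (Odd #(univ.filter fun i => ε i && a i j)))) :
    (∀ x ∈ V.image (bxor x'), 2 * D ∣ e x) ∨ 2 ^ 11 ≤ 2 ^ r * #((V.image (bxor x')).filter fun x => Odd (e x / D)) := by
  classical
  have hPV' : ∀ x, x ∈ V.image (bxor x') → ∀ a ∈ V, bxor x a ∈ V.image (bxor x') :=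
    fun x hx a ha => fl1_coset_vadd hadd rfl hx ha
  have H : ∀ b ∈ V.image (bxor x'), ∀ a : Fin (r + 1) → Fin (6 + 6) → Bool, (∀ i, a i ∈ V) →
      (2 : ℤ) ∣ ∑ ε : Fin (r + 1) → Bool, e (fun j => b j ^^ decide (Odd #(univ.filter fun i => ε i && a i j))) / D := by
    intro b hb a ha
    have hmul : ∑ ε : Fin (r + 1) → Bool, e (fun j => b j ^^ decide (Odd #(univ.filter fun i => ε i && a i j))) =
        D * ∑ ε : Fin (r + 1) → Bool, e (fun j => b j ^^ decide (Odd #(univ.filter fun i => ε i && a i j))) / D := by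
      rw [mul_sum]
      refine sum_congr rfl fun ε _ => ?_
      exact (Int.mul_ediv_cancel' (hdiv _ (ws_flatPt_mem V h0 (fun x => x ∈ V.image (bxor x')) hPV' (r + 1) b hb a ha ε))).symm
    have h := hcong b a
    rw [hmul, mul_comm (2 : ℤ) D] at h
    exact (mul_dvd_mul_iff_left hD.ne').1 h
  rcases ws_erm_round V h0 hadd hcardV x' (fun x => e x / D) r H with hall | hbig
  · left
    intro x hx
    obtain ⟨k, hk⟩ := hall x hx
    have hex := (Int.mul_ediv_cancel' (hdiv x hx)).symm
    rw [hex, hk]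
    exact ⟨k, by ring⟩
  · right; exact hbig

/-- **A level-5 side at `Φ ≥ 29/32` that is NOT exact off its odd hyperplane** (12 bits): cubic `f, g`, `W_g = 32u'`, some `u'` odd,
`Φ(f,g) ≥ 29/32`, and `u'(y) ≠ 2(−1)^{f(y)}` at some even point `y`.  Then `e = u' − 2(−1)^f` has `e² = 1` on the odd set `P`, and on
the even set `P'` exactly one of:
(a) `e² = 256` on a 4-point set `O ⊂ P'` and `e = 0` on `P' ∖ O`;
(b) `e² = 1024` at one point `x₁ ∈ P'` and `e = 0` on `P' ∖ {x₁}`;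
(c) `e/2` is odd somewhere on `P'` — and then (`l5t_layer2`) `e² = 4` on the 256-point set `{e/2 odd} ⊂ P'` with even 4-flat sections,
    `e = 0` on the rest of `P'`.
Finite-slice structure theorem; NOT summit progress. [this work] -/
theorem tw23_levelFive_ge2932_offP (f g : (Fin (6 + 6) → Bool) → Bool) (hf : IsDegLeFun 3 f) (hg : IsDegLeFun 3 g)
    (u' : (Fin (6 + 6) → Bool) → ℤ) (hu' : ∀ x, W (fun y => signOf (g y)) x = (2 : ℝ) ^ 5 * (u' x : ℝ))
    (hodd : ∃ x, Odd (u' x)) (hΦ : (29 / 32 : ℝ) ≤ forrelation f g)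
    (hne : ∃ y, ¬ Odd (u' y) ∧ u' y ≠ 2 * sZ (f y)) :
    (∀ x, Odd (u' x) → (u' x - 2 * sZ (f x)) ^ 2 = 1) ∧
    ((∃ O : Finset (Fin (6 + 6) → Bool), #O = 4 ∧ (∀ x ∈ O, ¬ Odd (u' x) ∧ (u' x - 2 * sZ (f x)) ^ 2 = 256) ∧
        (∀ x, ¬ Odd (u' x) → x ∉ O → u' x - 2 * sZ (f x) = 0)) ∨
      (∃ x₁ : Fin (6 + 6) → Bool, ¬ Odd (u' x₁) ∧ (u' x₁ - 2 * sZ (f x₁)) ^ 2 = 1024 ∧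
        (∀ x, ¬ Odd (u' x) → x ≠ x₁ → u' x - 2 * sZ (f x) = 0)) ∨
      (∃ x, ¬ Odd (u' x) ∧ Odd ((u' x - 2 * sZ (f x)) / 2))) := by
  classical
  obtain ⟨V, xP, x', h0, hadd, hcardV, hS, hS', hcardP, hcardP', hsq1, heven, hsum, hoff⟩ :=
    l5c_setup f g hg u' hu' hodd hΦ
  set P := univ.filter (fun x : Fin (6 + 6) → Bool => Odd (u' x)) with hPdef
  set P' := univ.filter (fun x : Fin (6 + 6) → Bool => ¬ Odd (u' x)) with hP'def
  set e : (Fin (6 + 6) → Bool) → ℤ := fun x => u' x - 2 * sZ (f x) with hedef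
  have hmemP' : ∀ x, x ∈ P' ↔ ¬ Odd (u' x) := fun x => by simp [hP'def]
  -- `P` is pinned as soon as the off-hyperplane energy is `1024`
  have hPall : ∑ x ∈ P', e x ^ 2 = 1024 → ∀ x, Odd (u' x) → e x ^ 2 = 1 := by
    intro hE x hx
    have hPsum : ∑ x ∈ P, e x ^ 2 ≤ 2048 := by
      have : ∑ x ∈ P, e x ^ 2 + ∑ x ∈ P', e x ^ 2 ≤ 3072 := hsum
      linarith
    have hc1 : ∀ x ∈ P, (1 : ℤ) ≤ e x ^ 2 := fun x hx => hsq1 x (by simpa [hPdef] using hx)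
    have hcP : (2048 : ℤ) ≤ 1 * #P := by rw [hcardP]; norm_num
    obtain ⟨h1, -, -⟩ := l5t_tight P P (fun x => e x ^ 2) 1 2048 Subset.rfl hc1 (fun x _ => sq_nonneg _) hPsum hcP
    exact h1 x (by simp [hPdef, hx])
  by_cases h2 : ∃ x, ¬ Odd (u' x) ∧ Odd (e x / 2)
  · -- configuration (c)
    obtain ⟨-, -, -, hP1, -⟩ := l5t_layer2 f g hf hg u' hu' hodd hΦ h2
    exact ⟨hP1, Or.inr (Or.inr h2)⟩
  push Not at h2
  -- `4 ∣ e` on `P'`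
  have hdiv4 : ∀ x ∈ V.image (bxor x'), (4 : ℤ) ∣ e x := by
    intro x hx
    rw [← hS'] at hx
    have hx' := (hmemP' x).1 hx
    have hev : Even (e x) := heven x hx'
    have hev2 : Even (e x / 2) := Int.not_odd_iff_even.1 (h2 x hx')
    obtain ⟨k, hk⟩ := hev2
    have := (Int.two_mul_ediv_two_of_even hev).symm
    rw [hk] at this
    exact ⟨k, by rw [this]; ring⟩
  -- `8 ∣ e` on `P'` (layer 4: an odd `e/4` would cost `16 · 128 > 1024`)
  have hdiv8 : ∀ x ∈ V.image (bxor x'), (8 : ℤ) ∣ e x := by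
    rcases l5t_double V x' h0 hadd hcardV e 4 (by norm_num) 4 hdiv4
      (fun b a => by rw [show (2 : ℤ) * 4 = 8 by norm_num]; exact l5c_flat5 f g hf hg u' hu' b a) with hall | hbig
    · intro x hx; have := hall x hx; rwa [show (2 : ℤ) * 4 = 8 by norm_num] at this
    · exfalso
      rw [← hS'] at hbig
      set O := P'.filter (fun x => Odd (e x / 4)) with hOdef
      have hO : 128 ≤ #O := by change 2 ^ 11 ≤ 2 ^ 4 * #O at hbig; norm_num at hbig; omega
      have hc : ∀ x ∈ O, (16 : ℤ) ≤ e x ^ 2 := by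
        intro x hx
        have hx' := mem_filter.1 hx
        have hxc : x ∈ V.image (bxor x') := by rw [← hS']; exact hx'.1
        have h := l5t_sq_ge_of_odd_quot (e x) 4 (by norm_num) (hdiv4 x hxc) hx'.2
        linarith
      have h1 := sum_le_sum hc
      rw [sum_const, nsmul_eq_mul] at h1
      have h2' : ∑ x ∈ O, e x ^ 2 ≤ ∑ x ∈ P', e x ^ 2 :=
        sum_le_sum_of_subset_of_nonneg (filter_subset _ _) fun x _ _ => sq_nonneg _
      have : (128 : ℤ) ≤ #O := by exact_mod_cast hO
      linarith
  -- `16 ∣ e` on `P'` (layer 8: an odd `e/8` would cost `64 · 32 > 1024`)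
  have hdiv16 : ∀ x ∈ V.image (bxor x'), (16 : ℤ) ∣ e x := by
    rcases l5t_double V x' h0 hadd hcardV e 8 (by norm_num) 6 hdiv8
      (fun b a => by rw [show (2 : ℤ) * 8 = 16 by norm_num]; exact l5c_flat7 f g hf hg u' hu' b a) with hall | hbig
    · intro x hx; have := hall x hx; rwa [show (2 : ℤ) * 8 = 16 by norm_num] at this
    · exfalso
      rw [← hS'] at hbig
      set O := P'.filter (fun x => Odd (e x / 8)) with hOdef
      have hO : 32 ≤ #O := by change 2 ^ 11 ≤ 2 ^ 6 * #O at hbig; norm_num at hbig; omega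
      have hc : ∀ x ∈ O, (64 : ℤ) ≤ e x ^ 2 := by
        intro x hx
        have hx' := mem_filter.1 hx
        have hxc : x ∈ V.image (bxor x') := by rw [← hS']; exact hx'.1
        have h := l5t_sq_ge_of_odd_quot (e x) 8 (by norm_num) (hdiv8 x hxc) hx'.2
        linarith
      have h1 := sum_le_sum hc
      rw [sum_const, nsmul_eq_mul] at h1
      have h2' : ∑ x ∈ O, e x ^ 2 ≤ ∑ x ∈ P', e x ^ 2 :=
        sum_le_sum_of_subset_of_nonneg (filter_subset _ _) fun x _ _ => sq_nonneg _
      have : (32 : ℤ) ≤ #O := by exact_mod_cast hO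
      linarith
  -- layer 16: configuration (a), or `32 ∣ e` on `P'`
  rcases l5t_double V x' h0 hadd hcardV e 16 (by norm_num) 9 hdiv16
    (fun b a => by rw [show (2 : ℤ) * 16 = 32 by norm_num]; exact l5c_flat10 f g hf hg u' hu' b a) with hall | hbig
  · -- `32 ∣ e` on `P'`: configuration (b)
    obtain ⟨y, hy, hyne⟩ := hne
    have hyP' : y ∈ P' := (hmemP' y).2 hy
    have hey : e y ≠ 0 := by intro h; apply hyne; have : e y = 0 := h; simp only [e] at this; linarith
    have hc : ∀ x ∈ ({y} : Finset (Fin (6 + 6) → Bool)), (1024 : ℤ) ≤ e x ^ 2 := by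
      intro x hx
      rw [mem_singleton] at hx; subst hx
      have h32 : (32 : ℤ) ∣ e x := by have := hall x (by rw [← hS']; exact hyP'); rwa [show (2 : ℤ) * 16 = 32 by norm_num] at this
      obtain ⟨q, hq⟩ := h32
      have hq0 : q ≠ 0 := by rintro rfl; apply hey; rw [hq]; ring
      have hq1 : 1 ≤ q ^ 2 := by
        have : q ≤ -1 ∨ 1 ≤ q := by omega
        have := tp_sq_ge (k := 1) (by norm_num) this
        linarith
      rw [hq]; nlinarith
    obtain ⟨hval, hrest, hE⟩ := l5t_tight P' {y} (fun x => e x ^ 2) 1024 1024 (singleton_subset_iff.2 hyP') hc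
      (fun x _ => sq_nonneg _) hoff (by simp)
    refine ⟨hPall hE, Or.inr (Or.inl ⟨y, hy, hval y (mem_singleton_self _), fun x hx hxy => ?_⟩)⟩
    have h := hrest x ((hmemP' x).2 hx) (by rwa [mem_singleton])
    exact pow_eq_zero_iff (n := 2) (by norm_num) |>.1 h
  · -- configuration (a)
    rw [← hS'] at hbig
    set O := P'.filter (fun x => Odd (e x / 16)) with hOdef
    have hO : 4 ≤ #O := by change 2 ^ 11 ≤ 2 ^ 9 * #O at hbig; norm_num at hbig; omega
    have hc : ∀ x ∈ O, (256 : ℤ) ≤ e x ^ 2 := by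
      intro x hx
      have hx' := mem_filter.1 hx
      have hxc : x ∈ V.image (bxor x') := by rw [← hS']; exact hx'.1
      have h := l5t_sq_ge_of_odd_quot (e x) 16 (by norm_num) (hdiv16 x hxc) hx'.2
      linarith
    have hO4 : (4 : ℤ) ≤ #O := by exact_mod_cast hO
    have hcO : (1024 : ℤ) ≤ 256 * #O := by linarith
    obtain ⟨hval, hrest, hE⟩ := l5t_tight P' O (fun x => e x ^ 2) 256 1024 (filter_subset _ _) hc (fun x _ => sq_nonneg _) hoff hcO
    have hO_le : #O ≤ 4 := by
      have h1 := sum_le_sum hc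
      rw [sum_const, nsmul_eq_mul] at h1
      have h2' : ∑ x ∈ O, e x ^ 2 ≤ ∑ x ∈ P', e x ^ 2 :=
        sum_le_sum_of_subset_of_nonneg (filter_subset _ _) fun x _ _ => sq_nonneg _
      have : (#O : ℤ) * 256 ≤ 1024 := by linarith
      have : (#O : ℤ) ≤ 4 := by linarith
      exact_mod_cast this
    refine ⟨hPall hE, Or.inl ⟨O, le_antisymm hO_le hO, fun x hx => ⟨(hmemP' x).1 (mem_filter.1 hx).1, hval x hx⟩,
      fun x hx hxO => ?_⟩⟩
    have h := hrest x ((hmemP' x).2 hx) hxO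
    exact pow_eq_zero_iff (n := 2) (by norm_num) |>.1 h

end Summit.QuantumAdvantage.QuantumAdvantage.Theorems.CubicForrelation.NearExactIsExact

end
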